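import Literature.AnabelianGeometry.EtaleTheta.Thm56SubdagProofs
import Literature.AnabelianGeometry.EtaleTheta.ThetaFrobenioidOfModel
import HarnessLib

/-!
# [EtTh] Prop. 5.5, sub-DAG leaf P55-L06 «independent of the choice of `S″`, `S‴` and the linear morphisms» —
# DERIVED from «the original functoriality of the isomorphism for `S″`» (proof-only)

Mochizuki, *The étale theta function and its Frobenioid-theoretic manifestations*, Publ. RIMS **45** (2009)
[EtTh], Prop. 5.5, proof p.328 (PDF p.102) l.2–11 [cite: MochizukiEtTh2009, Prop 5.5 proof p.328 (PDF p.102)]: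
"we may transport this isomorphism from `S″` to an arbitrary `(l, N)`-theta-saturated `S ∈ Ob(C)` by means
of linear morphisms `S″ → S` … which induce isomorphisms `(l·Δ_Θ)_{S″} ⊗ ℤ/Nℤ ⥲ (l·Δ_Θ)_S ⊗ ℤ/Nℤ`; …;
`μ_N(S) ⥲ μ_N(S″)` … — hence also a [functorial] isomorphism `(l·Δ_Θ)_S ⊗ ℤ/Nℤ ⥲ μ_N(S)`, which is
independent of the choice of `S″`, `S‴` and the linear morphisms `S″ → S`, `S″ → S‴` [precisely because of
the original "functoriality" of the isomorphism for `S″`]".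

abc-iut cell, layer L2, sub-DAG `plan/L2/SUBDAG-EtTh-Thm56.md` leaf **P55-L06** (`Thm56Sub.TransportIndependent`,
typed by abc-iut-w5-d020 in `Thm56SubdagStatements.lean`, p417674; «OPEN — owner ∅»; row granted to seat
abc-iut-w4-d008 by abc-iut-L2-lead 2026-08-26T02:50Z).  PROOF-ONLY companion: no definition, no new named fact;
every input is a hypothesis BINDER written out in the signature (cell rule D-0067 (1): laws of the abstract §5
datum are named binders, never smuggled `def`s).

WHAT IS PROVED.  At the one `l·N`-codomain `B_N` of the typed §5 data (`𝔉 : ThetaFrobenioid C D`), for the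
isomorphism `ρ₀ : (l·Δ_Θ)_{B_N} ⊗ ℤ/Nℤ ⥲ μ_N(B_N)` ("the isomorphism for `S″`"):

* `transportIndependent_of` — **P55-L06** `Thm56Sub.TransportIndependent 𝔉 ρ₀` from: (G) BASE TRANSITIVITY
  «the base maps of two linear `B_N ⟶ T` differ by an element of `Aut_D(B_N^bs)`» (`B_N^bs` Galois, p.331);
  (S) the tree's named `SgpCapSection` (`s^⊓-gp_N` splits `Aut_C(B_N) → Aut_D(B_N^bs)`; `B_N` Aut-ample, p.330);
  (U) the unit pull-back along a linear morphism depends only on its base morphism ([FrdI] Def. 1.3 (i)(b) —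
  the bracket of l.4; PROVED at abc-iut-L2-t9's `TemperedFrobenioidStub.ofModel` below,
  `ofModel_unitsPull_congr_base`, where it is definitional: `u ↦ Base(φ)^* u`); (F) FUNCTORIALITY OF `ρ₀` along
  the canonical lifts `s^⊓-gp_N(g)` («the original "functoriality" of the isomorphism for `S″`», restricted to these
  automorphisms of `S″ = B_N`); (I) «which induce isomorphisms» on `(l·Δ_Θ) ⊗ ℤ/Nℤ` — only INJECTIVITY of
  `Δ-push(φ)` for linear `φ : B_N ⟶ T` is used (and it is NECESSARY: see `transportIndependent_needs_injective`);
  plus the composition laws P55-L06b (`UnitsPullComp`, `LDeltaMapComp`; theorems at `ofModel` by abc-iut-w5-d020's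
  `Discharge/Sec5TransportLaws`).  Variant `transportIndependent_of_autTransitive`: from on-the-nose transitivity
  (T) `φ′ = α ≫ φ`, (F) for all of `Aut_C(B_N)`, and (I).
* `autFunctorial_unit` — functoriality (F) HOLDS along every UNIT `u ∈ O^×(B_N)`, for any `ρ₀`, from the laws
  already typed (T56-L09d `UnitsPullSpec`: pull-back along an isomorphism is conjugation; `O^×(B_N)` commutative,
  [FrdI] Rmk. 1.3.1 = `units_comm`; `Base(u) = id` so `Δ-push(u) = id`, law `LDeltaMapId`); `autFunctorial_trans` /
  `_symm` / `_refl` / `_closure` — (F) is closed under the group operations, so it suffices to check it on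
  GENERATORS (units: done here; the lifts `s^⊓-gp_N(g)`: the Kummer-determined computation of Prop. 5.2 (iii) +
  P55-L02b centrality, i.e. the T56-L09b/L09c content at the model).
* `transportIndependent_of_sameBase` — the unit case assembled: independence for pairs `φ, u ≫ φ` with NO
  functoriality hypothesis on `ρ₀`.
* `ModelFrobenioid.unitsPull_congr_baseMap`, `FrobenioidTheta.TemperedFrobenioidStub.ofModel_unitsPull_congr_base`
  — law (U) at the model Frobenioid / at `ofModel` (definitional: [FrdI] Thm. 5.2 (ii)).

HONEST FRAMING: kernel-checked implications between typed statements about the abstract §5 data; the laws (T),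
(F), (I) are hypotheses (what abc-iut-L2-t4/t9's genuine `ofBiKummerData`/`ofModel` instance must supply), not
asserted; [EtTh] is refereed; typed ≠ discharged; no side taken on [IUTchIII] Cor. 3.12.
-/

namespace Literature.AnabelianGeometry.EtaleTheta

open CategoryTheory
open FrobenioidCyclotomicRigidity

universe w v v' u u'

namespace ThetaFrobenioid

namespace Thm56Sub

variable {C : Type u} [Category.{v} C] {D : Type u'} [Category.{v'} D] {𝔉 : ThetaFrobenioid.{w} C D}

/-! ### `Δ-push` depends only on the base morphism -/

/-- `Δ-push(φ)` depends only on `φ^bs = Base(φ)` (it IS the transport of `(l·Δ_Θ)` along `φ^bs`, p.328 (PDF p.102)).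
[cite: MochizukiEtTh2009, Prop 5.5 proof p.328 (PDF p.102)] -/
theorem lDeltaModNMap_congr_base {S T : C} {φ ψ : S ⟶ T} (h : 𝔉.base.map φ = 𝔉.base.map ψ)
    (x : 𝔉.lDeltaModN S) : 𝔉.lDeltaModNMap φ x = 𝔉.lDeltaModNMap ψ x := by
  induction x using QuotientGroup.induction_on with
  | H z =>
    change QuotientGroup.mk (𝔉.lDeltaMap (𝔉.base.map φ) z) = QuotientGroup.mk (𝔉.lDeltaMap (𝔉.base.map ψ) z)
    rw [h]

/-- A UNIT acts trivially on `(l·Δ_Θ)_{B_N} ⊗ ℤ/Nℤ`: `Base(u) = id` ([FrdI] Def. 1.1; `base_map_units`) and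
`lDeltaMap id = id` (law P55-L06b `LDeltaMapId`).  [cite: MochizukiEtTh2009, Prop 5.5 proof p.328 (PDF p.102)] -/
theorem lDeltaModNMap_unit (hLi : LDeltaMapId 𝔉) {S : C} {u : Aut S} (hu : u ∈ 𝔉.units S)
    (x : 𝔉.lDeltaModN S) : 𝔉.lDeltaModNMap u.hom x = x := by
  have hb : 𝔉.base.map u.hom = 𝔉.base.map (𝟙 S) := by
    rw [𝔉.base_map_units S u hu, CategoryTheory.Functor.map_id]
  rw [lDeltaModNMap_congr_base hb, lDeltaModNMap_id hLi]

/-- Along a UNIT `u ∈ O^×(S)` the cyclotome pull-back is the identity: it is conjugation by `u` (T56-L09d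
`muTorsionPull_iso_eq`, from the law `UnitsPullSpec`) and `O^×(S) ⊇ μ_N(S)` is commutative ([FrdI] Rmk. 1.3.1).
[cite: MochizukiEtTh2009, Thm 5.6 proof p.329 (PDF p.103)] -/
theorem muTorsionPull_unit (hspec : UnitsPullSpec 𝔉) {S : C} {u : Aut S} (hu : u ∈ 𝔉.units S) (M : ℕ)
    (m : 𝔉.muTorsion S M) : 𝔉.muTorsionPull u.hom M m = m := by
  have hconj := muTorsionPull_iso_eq (𝔉 := 𝔉) hspec u M m
  -- `u.conjAut p = u * p * u⁻¹` in the group `Aut S`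
  have hform : ∀ p : Aut S, u.conjAut p = u * p * u⁻¹ := fun p => by
    rw [Iso.conjAut_apply, Aut.Aut_mul_def, Aut.Aut_mul_def, Aut.Aut_inv_def]
  rw [hform] at hconj
  apply Subtype.ext
  -- the pulled-back element is a unit, hence commutes with `u`
  have hp : ((𝔉.muTorsionPull u.hom M m : 𝔉.muTorsion S M) : Aut S) ∈ 𝔉.units S :=
    𝔉.muTorsion_le_units S M (𝔉.muTorsionPull u.hom M m).2
  have hcomm := setLike_mul_comm (s := 𝔉.units S) hu hp
  rw [hcomm, mul_inv_cancel_right] at hconj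
  exact hconj

/-! ### Functoriality of `ρ₀` for automorphisms of `B_N` (law (F)) is closed under the group operations -/

/-- (F) for the identity. [cite: MochizukiEtTh2009, Prop 5.5 proof p.328 (PDF p.102)] -/
theorem autFunctorial_refl (hUi : UnitsPullId 𝔉) (hLi : LDeltaMapId 𝔉)
    (ρ₀ : 𝔉.lDeltaModN 𝔉.BN ≃* 𝔉.muTorsion 𝔉.BN 𝔉.N) (x : 𝔉.lDeltaModN 𝔉.BN) :
    𝔉.muTorsionPull (Iso.refl 𝔉.BN).hom 𝔉.N (ρ₀ (𝔉.lDeltaModNMap (Iso.refl 𝔉.BN).hom x)) = ρ₀ x := by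
  rw [Iso.refl_hom, lDeltaModNMap_id hLi, muTorsionPull_id hUi]

/-- (F) is closed under composition of automorphisms (laws P55-L06b).
[cite: MochizukiEtTh2009, Prop 5.5 proof p.328 (PDF p.102)] -/
theorem autFunctorial_trans (hUc : UnitsPullComp 𝔉) (hLc : LDeltaMapComp 𝔉)
    (ρ₀ : 𝔉.lDeltaModN 𝔉.BN ≃* 𝔉.muTorsion 𝔉.BN 𝔉.N) {α β : 𝔉.BN ≅ 𝔉.BN}
    (hα : ∀ x, 𝔉.muTorsionPull α.hom 𝔉.N (ρ₀ (𝔉.lDeltaModNMap α.hom x)) = ρ₀ x)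
    (hβ : ∀ x, 𝔉.muTorsionPull β.hom 𝔉.N (ρ₀ (𝔉.lDeltaModNMap β.hom x)) = ρ₀ x) (x : 𝔉.lDeltaModN 𝔉.BN) :
    𝔉.muTorsionPull (α ≪≫ β).hom 𝔉.N (ρ₀ (𝔉.lDeltaModNMap (α ≪≫ β).hom x)) = ρ₀ x := by
  rw [Iso.trans_hom, lDeltaModNMap_comp hLc, muTorsionPull_comp hUc, hβ, hα]

/-- (F) is closed under inverses (the transports along an isomorphism are bijections, by the composition and
identity laws).  [cite: MochizukiEtTh2009, Prop 5.5 proof p.328 (PDF p.102)] -/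
theorem autFunctorial_symm (hUc : UnitsPullComp 𝔉) (hUi : UnitsPullId 𝔉) (hLc : LDeltaMapComp 𝔉)
    (hLi : LDeltaMapId 𝔉) (ρ₀ : 𝔉.lDeltaModN 𝔉.BN ≃* 𝔉.muTorsion 𝔉.BN 𝔉.N) {α : 𝔉.BN ≅ 𝔉.BN}
    (hα : ∀ x, 𝔉.muTorsionPull α.hom 𝔉.N (ρ₀ (𝔉.lDeltaModNMap α.hom x)) = ρ₀ x) (x : 𝔉.lDeltaModN 𝔉.BN) :
    𝔉.muTorsionPull α.symm.hom 𝔉.N (ρ₀ (𝔉.lDeltaModNMap α.symm.hom x)) = ρ₀ x := by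
  -- apply (F) for `α` to `y := Δ-push(α⁻¹) x` and pull back along `α⁻¹`
  have h1 := hα (𝔉.lDeltaModNMap α.symm.hom x)
  rw [← lDeltaModNMap_comp hLc, Iso.symm_hom, Iso.inv_hom_id, lDeltaModNMap_id hLi] at h1
  -- `h1 : μ-pull(α) (ρ₀ x) = ρ₀ (Δ-push(α⁻¹) x)`
  rw [Iso.symm_hom]
  rw [← h1, ← muTorsionPull_comp hUc, Iso.inv_hom_id, muTorsionPull_id hUi]

/-- **Law (F) for UNITS** — «the original functoriality of the isomorphism for `S″`» holds along every
`u ∈ O^×(B_N)`, for ANY `ρ₀`: units act trivially on both cyclotomes (`lDeltaModNMap_unit`, `muTorsionPull_unit`).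
[cite: MochizukiEtTh2009, Prop 5.5 proof p.328 (PDF p.102)] -/
theorem autFunctorial_unit (hspec : UnitsPullSpec 𝔉) (hLi : LDeltaMapId 𝔉)
    (ρ₀ : 𝔉.lDeltaModN 𝔉.BN ≃* 𝔉.muTorsion 𝔉.BN 𝔉.N) {u : Aut 𝔉.BN} (hu : u ∈ 𝔉.units 𝔉.BN)
    (x : 𝔉.lDeltaModN 𝔉.BN) : 𝔉.muTorsionPull u.hom 𝔉.N (ρ₀ (𝔉.lDeltaModNMap u.hom x)) = ρ₀ x := by
  rw [lDeltaModNMap_unit hLi hu, muTorsionPull_unit hspec hu]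

/-! ### P55-L06 from base transitivity (G), the section `s^⊓-gp_N`, functoriality along the lifts (F), injectivity (I) -/

/-- `μ-pull(φ)` depends only on the unit pull-back `unitsPull φ` (it IS its restriction to `μ_M`).
[cite: MochizukiEtTh2009, Prop 5.5 proof p.328 (PDF p.102)] -/
theorem muTorsionPull_congr {S T : C} {φ ψ : S ⟶ T} (h : 𝔉.unitsPull φ = 𝔉.unitsPull ψ) (M : ℕ)
    (u : 𝔉.muTorsion T M) : 𝔉.muTorsionPull φ M u = 𝔉.muTorsionPull ψ M u := by
  apply Subtype.ext
  change ((𝔉.unitsPull φ ⟨u.1, u.2.1⟩ : 𝔉.units S) : Aut S) = ((𝔉.unitsPull ψ ⟨u.1, u.2.1⟩ : 𝔉.units S) : Aut S)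
  rw [h]

/-- **[EtTh] Prop. 5.5, sub-node P55-L06 `TransportIndependent ρ₀` DERIVED** («independent of the choice of `S″`,
`S‴` and the linear morphisms `S″ → S`, `S″ → S‴` [precisely because of the original "functoriality" of the
isomorphism for `S″`]», p.328 (PDF p.102) l.8–11), at the codomain `B_N` of the typed §5 data, from:
(G) `hgal` — the base maps of two linear `B_N ⟶ T`, `T` theta-saturated, differ by an element of `Aut_D(B_N^bs)`
(«`B_N^bs` is Galois», p.331 (PDF p.105): `Hom_D(B_N^bs, T^bs)` is an `Aut_D(B_N^bs)`-torsor);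
(S) `hsec` — `s^⊓-gp_N` is a section of `Aut_C(B_N) → Aut_D(B_N^bs)` (the tree's named `SgpCapSection`; «`B_N` is
Aut-ample», p.330 (PDF p.104));
(U) `hUb` — the unit pull-back along a LINEAR morphism depends only on its base morphism ([FrdI] Def. 1.3 (i)(b),
the bracket of l.4; at the model `u ↦ Base(φ)^* u`, [FrdI] Thm. 5.2 (ii));
(F) `hfun` — functoriality of `ρ₀` along the canonical lifts `s^⊓-gp_N(g)`, `g ∈ Aut_D(B_N^bs)` (the printed
reason «the original functoriality of the isomorphism for `S″`», here only for these automorphisms of `S″ = B_N`);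
(I) `hinj` — linear morphisms out of `B_N` «induce isomorphisms» on `(l·Δ_Θ) ⊗ ℤ/Nℤ` (l.5–7; injectivity suffices);
and the composition laws P55-L06b.  Proof: by (G)+(S) the morphism `φ″ := s^⊓-gp_N(g) ≫ φ` has the base map of
`φ′`, so by `lDeltaModNMap_congr_base` and (U) BOTH transports along `φ′` and `φ″` coincide; for `φ″` write
`Δ-push(φ) x = Δ-push(φ) (Δ-push(s^⊓-gp_N(g)) x′)`, use (I), then (F).
[cite: MochizukiEtTh2009, Prop 5.5 proof p.328 (PDF p.102)] -/
theorem transportIndependent_of (hUc : UnitsPullComp 𝔉) (hLc : LDeltaMapComp 𝔉)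
    (ρ₀ : 𝔉.lDeltaModN 𝔉.BN ≃* 𝔉.muTorsion 𝔉.BN 𝔉.N)
    (hUb : ∀ {S T : C} (φ ψ : S ⟶ T), 𝔉.IsLinear φ → 𝔉.IsLinear ψ → 𝔉.base.map φ = 𝔉.base.map ψ →
      𝔉.unitsPull φ = 𝔉.unitsPull ψ)
    (hsec : 𝔉.SgpCapSection)
    (hgal : ∀ (T : C), 𝔉.IsThetaSaturated T → ∀ (φ φ' : 𝔉.BN ⟶ T), 𝔉.IsLinear φ → 𝔉.IsLinear φ' →
      ∃ g : Aut (𝔉.base.obj 𝔉.BN), 𝔉.base.map φ' = g.hom ≫ 𝔉.base.map φ)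
    (hfun : ∀ (g : Aut (𝔉.base.obj 𝔉.BN)) (x : 𝔉.lDeltaModN 𝔉.BN),
      𝔉.muTorsionPull (𝔉.sgpCap g).hom 𝔉.N (ρ₀ (𝔉.lDeltaModNMap (𝔉.sgpCap g).hom x)) = ρ₀ x)
    (hinj : ∀ (T : C), 𝔉.IsThetaSaturated T → ∀ (φ : 𝔉.BN ⟶ T), 𝔉.IsLinear φ →
      Function.Injective (𝔉.lDeltaModNMap φ)) :
    TransportIndependent 𝔉 ρ₀ := by
  intro T hT φ φ' hφ hφ' x x' u hΔ hμ
  obtain ⟨g, hg⟩ := hgal T hT φ φ' hφ hφ'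
  -- the base map of the lift `s^⊓-gp_N(g)` is `g`
  have hαb : 𝔉.base.map (𝔉.sgpCap g).hom = g.hom := congrArg Iso.hom (hsec g)
  have hb : 𝔉.base.map φ' = 𝔉.base.map ((𝔉.sgpCap g).hom ≫ φ) := by
    rw [CategoryTheory.Functor.map_comp, hαb, hg]
  have hlin'' : 𝔉.IsLinear ((𝔉.sgpCap g).hom ≫ φ) := isLinear_comp (𝔉.isLinear_of_aut _) hφ
  -- both transports along `φ′` agree with those along `φ″ = s^⊓-gp_N(g) ≫ φ`
  rw [lDeltaModNMap_congr_base hb, lDeltaModNMap_comp hLc] at hΔ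
  rw [muTorsionPull_congr (hUb φ' _ hφ' hlin'' hb), muTorsionPull_comp hUc, hμ, hinj T hT φ hφ hΔ, hfun g x']

/-- **P55-L06, variant with automorphism transitivity** (no hypothesis on `unitsPull`): if two linear `B_N ⟶ T`
differ on the nose by an automorphism of `B_N` — (T) `htrans` — and `ρ₀` is functorial along ALL automorphisms of
`B_N` — (F) `hfun` — then, with (I), `TransportIndependent ρ₀`.  ((T) is stronger than (G)+(S): in the model two
linear morphisms over one base map differ by a unit only when their zero divisors agree, so the main entry point is
`transportIndependent_of`.)  [cite: MochizukiEtTh2009, Prop 5.5 proof p.328 (PDF p.102)] -/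
theorem transportIndependent_of_autTransitive (hUc : UnitsPullComp 𝔉) (hLc : LDeltaMapComp 𝔉)
    (ρ₀ : 𝔉.lDeltaModN 𝔉.BN ≃* 𝔉.muTorsion 𝔉.BN 𝔉.N)
    (htrans : ∀ (T : C), 𝔉.IsThetaSaturated T → ∀ (φ φ' : 𝔉.BN ⟶ T), 𝔉.IsLinear φ → 𝔉.IsLinear φ' →
      ∃ α : 𝔉.BN ≅ 𝔉.BN, φ' = α.hom ≫ φ)
    (hfun : ∀ (α : 𝔉.BN ≅ 𝔉.BN) (x : 𝔉.lDeltaModN 𝔉.BN),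
      𝔉.muTorsionPull α.hom 𝔉.N (ρ₀ (𝔉.lDeltaModNMap α.hom x)) = ρ₀ x)
    (hinj : ∀ (T : C), 𝔉.IsThetaSaturated T → ∀ (φ : 𝔉.BN ⟶ T), 𝔉.IsLinear φ →
      Function.Injective (𝔉.lDeltaModNMap φ)) :
    TransportIndependent 𝔉 ρ₀ := by
  intro T hT φ φ' hφ hφ' x x' u hΔ hμ
  obtain ⟨α, rfl⟩ := htrans T hT φ φ' hφ hφ'
  rw [lDeltaModNMap_comp hLc] at hΔ
  have hx : x = 𝔉.lDeltaModNMap α.hom x' := hinj T hT φ hφ hΔ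
  rw [muTorsionPull_comp hUc, hμ, hx, hfun α x']

/-- The hypothesis (F) of `transportIndependent_of` only needs to be checked on a GENERATING family: if every
automorphism produced by (T) is a composite of automorphisms satisfying (F) — e.g. units (`autFunctorial_unit`) and
lifts `s^⊓-gp_N(g)` — then (F) holds for it (`autFunctorial_trans`/`_symm`/`_refl`).  Packaged form: (F) holds on
the subgroup CLOSURE of any set of automorphisms on which it holds.
[cite: MochizukiEtTh2009, Prop 5.5 proof p.328 (PDF p.102)] -/
theorem autFunctorial_closure (hUc : UnitsPullComp 𝔉) (hUi : UnitsPullId 𝔉) (hLc : LDeltaMapComp 𝔉)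
    (hLi : LDeltaMapId 𝔉) (ρ₀ : 𝔉.lDeltaModN 𝔉.BN ≃* 𝔉.muTorsion 𝔉.BN 𝔉.N) (G : Set (Aut 𝔉.BN))
    (hG : ∀ α ∈ G, ∀ x, 𝔉.muTorsionPull (α : 𝔉.BN ≅ 𝔉.BN).hom 𝔉.N (ρ₀ (𝔉.lDeltaModNMap α.hom x)) = ρ₀ x)
    {α : Aut 𝔉.BN} (hα : α ∈ Subgroup.closure G) (x : 𝔉.lDeltaModN 𝔉.BN) :
    𝔉.muTorsionPull α.hom 𝔉.N (ρ₀ (𝔉.lDeltaModNMap α.hom x)) = ρ₀ x := by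
  revert x
  refine Subgroup.closure_induction (p := fun α _ => ∀ x,
    𝔉.muTorsionPull α.hom 𝔉.N (ρ₀ (𝔉.lDeltaModNMap α.hom x)) = ρ₀ x) ?_ ?_ ?_ ?_ hα
  · exact fun α hαG => hG α hαG
  · intro x
    exact autFunctorial_refl hUi hLi ρ₀ x
  · intro α β _ _ hα hβ x
    -- `α * β = β ≪≫ α` in `Aut`
    rw [Aut.Aut_mul_def]
    exact autFunctorial_trans hUc hLc ρ₀ hβ hα x
  · intro α _ hα x
    rw [Aut.Aut_inv_def]
    exact autFunctorial_symm hUc hUi hLc hLi ρ₀ hα x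

/-- **P55-L06 for pairs differing by a UNIT — unconditionally in `ρ₀`**: if `φ′ = u ≫ φ` with `u ∈ O^×(B_N)`
(two linear morphisms over the SAME base map, Def. 3.6 (ii)), the two transports of ANY `ρ₀` agree, given
injectivity (I) of `Δ-push(φ)` and the laws P55-L06b/T56-L09d.  [cite: MochizukiEtTh2009, Prop 5.5 proof p.328 (PDF p.102)] -/
theorem transportIndependent_of_sameBase (hUc : UnitsPullComp 𝔉) (hLc : LDeltaMapComp 𝔉)
    (hLi : LDeltaMapId 𝔉) (hspec : UnitsPullSpec 𝔉) (ρ₀ : 𝔉.lDeltaModN 𝔉.BN ≃* 𝔉.muTorsion 𝔉.BN 𝔉.N)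
    {T : C} {φ : 𝔉.BN ⟶ T} (hinj : Function.Injective (𝔉.lDeltaModNMap φ))
    {u : Aut 𝔉.BN} (hu : u ∈ 𝔉.units 𝔉.BN) (x x' : 𝔉.lDeltaModN 𝔉.BN) (m : 𝔉.muTorsion T 𝔉.N)
    (hΔ : 𝔉.lDeltaModNMap φ x = 𝔉.lDeltaModNMap (u.hom ≫ φ) x')
    (hμ : 𝔉.muTorsionPull φ 𝔉.N m = ρ₀ x) : 𝔉.muTorsionPull (u.hom ≫ φ) 𝔉.N m = ρ₀ x' := by
  rw [lDeltaModNMap_comp hLc, lDeltaModNMap_unit hLi hu] at hΔ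
  rw [muTorsionPull_comp hUc, hμ, hinj hΔ, muTorsionPull_unit hspec hu]

/-- **Why (I) cannot be dropped**: for `φ = φ′` the typed P55-L06 says `Δ-push(φ) x = Δ-push(φ) x′ ∧ μ-pull(φ) u =
ρ₀ x → μ-pull(φ) u = ρ₀ x′`, i.e. it FORCES `ρ₀ x = ρ₀ x′`, hence `x = x′`, whenever `μ-pull(φ)` hits `ρ₀ x` — so on
the range where the hypothesis is satisfiable, `TransportIndependent ρ₀` itself implies the injectivity of
`Δ-push(φ)` (print: the linear morphisms in question «induce isomorphisms»).
[cite: MochizukiEtTh2009, Prop 5.5 proof p.328 (PDF p.102)] -/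
theorem transportIndependent_needs_injective (ρ₀ : 𝔉.lDeltaModN 𝔉.BN ≃* 𝔉.muTorsion 𝔉.BN 𝔉.N)
    (hind : TransportIndependent 𝔉 ρ₀) {T : C} (hT : 𝔉.IsThetaSaturated T) {φ : 𝔉.BN ⟶ T}
    (hφ : 𝔉.IsLinear φ) {x x' : 𝔉.lDeltaModN 𝔉.BN} (hΔ : 𝔉.lDeltaModNMap φ x = 𝔉.lDeltaModNMap φ x')
    (hsurj : ∃ m : 𝔉.muTorsion T 𝔉.N, 𝔉.muTorsionPull φ 𝔉.N m = ρ₀ x) : x = x' := by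
  obtain ⟨m, hm⟩ := hsurj
  have h := hind T hT φ φ hφ hφ x x' m hΔ hm
  rw [hm] at h
  exact ρ₀.injective h

end Thm56Sub

end ThetaFrobenioid

end Literature.AnabelianGeometry.EtaleTheta

/-! ### Law (U) at the model: the unit pull-back of the model Frobenioid depends only on the base morphism -/

namespace Literature.AlgebraicGeometry.Frobenioids

namespace ModelFrobenioid

open CategoryTheory Opposite

universe w' v'' u''

variable {D : Type u''} [Category.{v''} D] {Φ B : Dᵒᵖ ⥤ CommMonCat.{w'}} {DivB : B ⟶ monoidGp Φ}

/-- **Law (U) on the model Frobenioid**: `unitsPull φ` — `(Div u, u) ↦ (Φ(Base φ)(Div u), B(Base φ)(u))`,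
[FrdI] Thm. 5.2 (ii) — depends only on `Base(φ)` (for every `φ`, linear or not).
[cite: MochizukiFrdI2008, Thm. 5.2(ii) p.101] -/
theorem unitsPull_congr_baseMap {X Y : ModelFrobenioid Φ B DivB} {φ ψ : X ⟶ Y} (h : baseMap φ = baseMap ψ) :
    unitsPull φ = unitsPull ψ := by
  ext τ : 1
  apply Subtype.ext
  apply Aut.ext
  apply hom_ext
  · rw [(unitsPull φ τ).2.2, (unitsPull ψ τ).2.2]
  · rw [(unitsPull φ τ).2.1, (unitsPull ψ τ).2.1]
  · change (Φ.map (baseMap φ).op).hom (div τ.1.hom) = (Φ.map (baseMap ψ).op).hom (div τ.1.hom)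
    rw [h]
  · change (B.map (baseMap φ).op).hom (unit τ.1.hom) = (B.map (baseMap ψ).op).hom (unit τ.1.hom)
    rw [h]

end ModelFrobenioid

end Literature.AlgebraicGeometry.Frobenioids

namespace Literature.AnabelianGeometry.EtaleTheta

namespace FrobenioidTheta

open CategoryTheory Opposite Literature.AlgebraicGeometry.Frobenioids

universe w' v'' u''

variable {D : Type u''} [Category.{v''} D] {Φ B : Dᵒᵖ ⥤ CommMonCat.{w'}} {DivB : B ⟶ monoidGp Φ}
  (hΦ : ∀ A : Dᵒᵖ, IsIntegral (Φ.obj A)) (IsBFT : MorphismProperty (ModelFrobenioid Φ B DivB))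

/-- **Law (U) at abc-iut-L2-t9's `TemperedFrobenioidStub.ofModel`** (the carrier of abc-iut-L2-t4's
`ThetaFrobenioid.ofBiKummerData`): the stub's `unitsPull` IS `ModelFrobenioid.unitsPull`, so two morphisms with the
same base morphism pull units back identically — the hypothesis `hUb` of `Thm56Sub.transportIndependent_of`
(even without its linearity premises).  [cite: MochizukiEtTh2009, Prop 5.5 proof p.328 (PDF p.102)] -/
theorem TemperedFrobenioidStub.ofModel_unitsPull_congr_base {S T : ModelFrobenioid Φ B DivB} {φ ψ : S ⟶ T}
    (h : (TemperedFrobenioidStub.ofModel Φ B DivB hΦ IsBFT).pre.base.map φ =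
      (TemperedFrobenioidStub.ofModel Φ B DivB hΦ IsBFT).pre.base.map ψ) :
    (TemperedFrobenioidStub.ofModel Φ B DivB hΦ IsBFT).unitsPull φ =
      (TemperedFrobenioidStub.ofModel Φ B DivB hΦ IsBFT).unitsPull ψ :=
  ModelFrobenioid.unitsPull_congr_baseMap h

end FrobenioidTheta

end Literature.AnabelianGeometry.EtaleTheta
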